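import Mathlib

/-!
# Crux `UniformPhotonSphereChannelsR` (K1R, stmt-FinalStateConjecture-14074), line
# `crum-peeling-recessive-tower` — stub `stub_shiftFromCoeffs`, part 1: the power series at a point

Support file for the registered stub `stub_shiftFromCoeffs` (Theorems B+D of the line: the
division-free shift bounds for the last recessive Riccati variable `W = −1/D`,
`D = r · 𝐠(M/r)`, from the coefficient bounds of `𝐠 = ∑ Gₙ zⁿ = 1/∑ Ωₙ zⁿ`).

Elementary real power series with geometrically bounded coefficients (prefix `sfc_`):

* `sfc_summable_of_abs_le_geom`, `sfc_abs_le_of_hasSum`, `sfc_abs_tsum_le` — comparison with a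
  geometric series `B qⁿ`, `0 ≤ q < 1`;
* `sfc_summable_norm_pow`, `sfc_summable_pow` — (absolute) convergence of `∑ aₙ yⁿ` for
  `|aₙ| ≤ Kⁿ`, `K|y| < 1`;
* `sfc_hasDerivAt_tsum_pow` — **term-wise differentiation**
  `HasDerivAt (z ↦ ∑' aₙ zⁿ) (∑' aₙ (n yⁿ⁻¹)) y` for `|aₙ| ≤ Kⁿ`, `|y| < 1/(2K)`
  (Mathlib's `hasDerivAt_tsum_of_isPreconnected` on the interval `(−1/(2K), 1/(2K))` with the
  majorant `2K · n · 2⁻ⁿ`);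
* `sfc_tsum_mul_tsum_eq_one` — the Cauchy product of two absolutely convergent power series whose
  coefficient convolution is the unit sequence equals `1`;
* the point package `sfc_point` for `G₀ = 1`, `|G₁| ≤ R`, `|Gₙ| ≤ Rⁿ⁻¹` (`n ≥ 2`), `R ≥ 1` at
  `0 ≤ w`, `R w ≤ 1/200`: with `𝐠(z) = ∑ Gₙ zⁿ`, `𝒟𝐠(z) = ∑ (1 − n) Gₙ zⁿ` — both differentiable
  at `w`, `𝒟𝐠(w) = 𝐠(w) − w 𝐠'(w)` (`sfc_hasSum_dg`), `|𝐠(w) − 1| ≤ 1/100`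
  (`sfc_abs_g_sub_one_le`), `|𝒟𝐠(w) − 1| ≤ w/100` (`sfc_abs_dg_sub_one_le`, this is where the
  fine bound `|Gₙ| ≤ Rⁿ⁻¹` enters), `|𝒟𝐠'(w)| ≤ 1/50` (`sfc_abs_dg₁_le`).
-/

-- `Summit.<S>.<S>` repeats a namespace component by design (D-0017); off here as in the lakefile.
set_option linter.dupNamespace false

noncomputable section

namespace Summit.FinalStateConjecture.FinalStateConjecture.Theorems.CrumPeelingRecessiveTower

open Filter Set Topology

/-- Comparison with a geometric series: `|cₙ| ≤ B qⁿ` with `0 ≤ q < 1` makes `∑ cₙ` summable. -/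
theorem sfc_summable_of_abs_le_geom {c : ℕ → ℝ} {B q : ℝ} (hq0 : 0 ≤ q) (hq1 : q < 1)
    (h : ∀ n, |c n| ≤ B * q ^ n) : Summable c :=
  Summable.of_norm_bounded ((summable_geometric_of_lt_one hq0 hq1).mul_left B) fun n => by
    rw [Real.norm_eq_abs]; exact h n

/-- `|cₙ| ≤ B qⁿ`, `0 ≤ q < 1` and `HasSum c S` give `|S| ≤ B / (1 − q)`. -/
theorem sfc_abs_le_of_hasSum {c : ℕ → ℝ} {B q S : ℝ} (hq0 : 0 ≤ q) (hq1 : q < 1)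
    (hS : HasSum c S) (h : ∀ n, |c n| ≤ B * q ^ n) : |S| ≤ B / (1 - q) := by
  have hg : HasSum (fun n : ℕ => B * q ^ n) (B / (1 - q)) := by
    rw [div_eq_mul_inv]
    exact (hasSum_geometric_of_lt_one hq0 hq1).mul_left B
  have := hS.norm_le_of_bounded hg fun n => by rw [Real.norm_eq_abs]; exact h n
  rwa [Real.norm_eq_abs] at this

/-- `|cₙ| ≤ B qⁿ`, `0 ≤ q < 1` give `|∑' cₙ| ≤ B / (1 − q)`. -/
theorem sfc_abs_tsum_le {c : ℕ → ℝ} {B q : ℝ} (hq0 : 0 ≤ q) (hq1 : q < 1)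
    (h : ∀ n, |c n| ≤ B * q ^ n) : |∑' n, c n| ≤ B / (1 - q) :=
  sfc_abs_le_of_hasSum hq0 hq1 (sfc_summable_of_abs_le_geom hq0 hq1 h).hasSum h

/-- Absolute convergence of `∑ aₙ yⁿ` for `|aₙ| ≤ Kⁿ` and `K |y| < 1`. -/
theorem sfc_summable_norm_pow {a : ℕ → ℝ} {K y : ℝ} (hK : 0 ≤ K) (hKy : K * |y| < 1)
    (ha : ∀ n, |a n| ≤ K ^ n) : Summable fun n => ‖a n * y ^ n‖ := by
  refine sfc_summable_of_abs_le_geom (B := 1) (q := K * |y|) (mul_nonneg hK (abs_nonneg y)) hKy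
    fun n => ?_
  rw [Real.norm_eq_abs, abs_abs, abs_mul, abs_pow, one_mul, mul_pow]
  exact mul_le_mul_of_nonneg_right (ha n) (pow_nonneg (abs_nonneg y) n)

/-- Convergence of `∑ aₙ yⁿ` for `|aₙ| ≤ Kⁿ` and `K |y| < 1`. -/
theorem sfc_summable_pow {a : ℕ → ℝ} {K y : ℝ} (hK : 0 ≤ K) (hKy : K * |y| < 1)
    (ha : ∀ n, |a n| ≤ K ^ n) : Summable fun n => a n * y ^ n :=
  (sfc_summable_norm_pow hK hKy ha).of_norm

/-- **Term-wise differentiation** of a real power series with `|aₙ| ≤ Kⁿ` (`K > 0`) at a point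
`|y| < 1/(2K)`: `HasDerivAt (z ↦ ∑' aₙ zⁿ) (∑' aₙ (n yⁿ⁻¹)) y`. -/
theorem sfc_hasDerivAt_tsum_pow {a : ℕ → ℝ} {K : ℝ} (hK : 0 < K) (ha : ∀ n, |a n| ≤ K ^ n)
    {y : ℝ} (hy : |y| < 1 / (2 * K)) :
    HasDerivAt (fun z => ∑' n, a n * z ^ n) (∑' n, a n * ((n : ℝ) * y ^ (n - 1))) y := by
  set ρ : ℝ := 1 / (2 * K) with hρ
  have hρ0 : 0 < ρ := by positivity
  have hKρ : K * ρ = 1 / 2 := by rw [hρ]; field_simp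
  -- the summable majorant `2K · n · 2⁻ⁿ` of the term-wise derivatives on `(−ρ, ρ)`
  have hhalf : ‖(1 / 2 : ℝ)‖ < 1 := by
    rw [Real.norm_of_nonneg (by norm_num : (0 : ℝ) ≤ 1 / 2)]; norm_num
  have hu : Summable fun n : ℕ => 2 * K * ((n : ℝ) * (1 / 2 : ℝ) ^ n) :=
    (hasSum_coe_mul_geometric_of_norm_lt_one hhalf).summable.mul_left (2 * K)
  refine hasDerivAt_tsum_of_isPreconnected (g := fun n z => a n * z ^ n)
    (g' := fun n z => a n * ((n : ℝ) * z ^ (n - 1))) (t := Ioo (-ρ) ρ) (y₀ := 0) hu isOpen_Ioo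
    (convex_Ioo _ _).isPreconnected (fun n z _ => (hasDerivAt_pow n z).const_mul (a n)) ?_ ?_ ?_ ?_
  · -- the bound `|aₙ n zⁿ⁻¹| ≤ 2K n 2⁻ⁿ` on `(−ρ, ρ)`
    intro n z hz
    have hz' : |z| ≤ ρ := (abs_lt.2 hz).le
    rw [Real.norm_eq_abs, abs_mul, abs_mul, abs_pow, Nat.abs_cast]
    cases n with
    | zero => simp
    | succ m =>
      rw [Nat.add_sub_cancel]
      push_cast
      have h2 : (1 / 2 : ℝ) ^ (m + 1) = (K * ρ) ^ m * (1 / 2) := by rw [hKρ, pow_succ]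
      calc |a (m + 1)| * (((m : ℝ) + 1) * |z| ^ m)
          ≤ K ^ (m + 1) * (((m : ℝ) + 1) * ρ ^ m) := by gcongr; exact ha (m + 1)
        _ = 2 * K * (((m : ℝ) + 1) * (1 / 2 : ℝ) ^ (m + 1)) := by rw [h2, mul_pow]; ring
  · exact ⟨by linarith, hρ0⟩
  · refine summable_of_ne_finset_zero (s := {0}) fun n hn => ?_
    rw [Finset.mem_singleton] at hn
    simp [zero_pow hn]
  · exact abs_lt.1 hy

/-- **Cauchy product.**  If `∑ₖ Gₖ Ω_{n−k} = [n = 0]` and `∑ Gₙ yⁿ`, `∑ Ωₙ yⁿ` converge absolutely,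
then `(∑' Gₙ yⁿ) · (∑' Ωₙ yⁿ) = 1`. -/
theorem sfc_tsum_mul_tsum_eq_one {G Ω : ℕ → ℝ} {y : ℝ}
    (hG : Summable fun n => ‖G n * y ^ n‖) (hΩ : Summable fun n => ‖Ω n * y ^ n‖)
    (hinv : ∀ n, ∑ i ∈ Finset.range (n + 1), G i * Ω (n - i) = if n = 0 then 1 else 0) :
    (∑' n, G n * y ^ n) * (∑' n, Ω n * y ^ n) = 1 := by
  rw [tsum_mul_tsum_eq_tsum_sum_range_of_summable_norm hG hΩ]
  have hterm : ∀ n, ∑ k ∈ Finset.range (n + 1), G k * y ^ k * (Ω (n - k) * y ^ (n - k)) =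
      (if n = 0 then 1 else 0) * y ^ n := by
    intro n
    rw [← hinv n, Finset.sum_mul]
    refine Finset.sum_congr rfl fun k hk => ?_
    have hkn : k ≤ n := Nat.lt_succ_iff.1 (Finset.mem_range.1 hk)
    calc G k * y ^ k * (Ω (n - k) * y ^ (n - k))
        = G k * Ω (n - k) * (y ^ k * y ^ (n - k)) := by ring
      _ = G k * Ω (n - k) * y ^ n := by rw [← pow_add, Nat.add_sub_cancel' hkn]
  rw [tsum_congr hterm, tsum_eq_single 0 fun n hn => by simp [hn]]
  simp

/-- `(n + 1)(n + 2) ≤ 2 · 4ⁿ` (in `ℝ`): the counting bound behind the tail majorant of the second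
term-wise derivative. -/
theorem sfc_succ_mul_succ_le (n : ℕ) : ((n : ℝ) + 1) * ((n : ℝ) + 2) ≤ 2 * 4 ^ n := by
  have h1 : (n : ℝ) + 1 ≤ 2 ^ n := by exact_mod_cast (Nat.lt_two_pow_self : n < 2 ^ n)
  have h2 : (n : ℝ) + 2 ≤ 2 * 2 ^ n := by linarith
  calc ((n : ℝ) + 1) * ((n : ℝ) + 2) ≤ 2 ^ n * (2 * 2 ^ n) := by
        gcongr
    _ = 2 * 4 ^ n := by
        rw [show (4 : ℝ) = 2 ^ 2 by norm_num, ← pow_mul, pow_mul']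
        ring

/-- `|1 − n| ≤ 2ⁿ` (in `ℝ`): the coefficients `(1 − n) Gₙ` of the Euler-type operator
`𝐠 − w 𝐠'` are again geometrically bounded, with ratio doubled. -/
theorem sfc_abs_one_sub_le_two_pow (n : ℕ) : |1 - (n : ℝ)| ≤ 2 ^ n := by
  have h1 : (n : ℝ) + 1 ≤ 2 ^ n := by exact_mod_cast (Nat.lt_two_pow_self : n < 2 ^ n)
  have h0 : (0 : ℝ) ≤ n := n.cast_nonneg
  rw [abs_le]
  constructor <;> linarith

/-- `(n + 1) tⁿ ≤ (1/100)ⁿ` for `0 ≤ t ≤ 1/200`. -/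
theorem sfc_succ_mul_pow_le {t : ℝ} (ht0 : 0 ≤ t) (ht : t ≤ 1 / 200) (n : ℕ) :
    ((n : ℝ) + 1) * t ^ n ≤ (1 / 100) ^ n := by
  have h1 : (n : ℝ) + 1 ≤ 2 ^ n := by exact_mod_cast (Nat.lt_two_pow_self : n < 2 ^ n)
  calc ((n : ℝ) + 1) * t ^ n ≤ 2 ^ n * (1 / 200) ^ n :=
        mul_le_mul h1 (pow_le_pow_left₀ ht0 ht n) (by positivity) (by positivity)
    _ = (1 / 100) ^ n := by rw [← mul_pow]; norm_num

/-- `(n + 1)(n + 2) tⁿ ≤ 2 (1/50)ⁿ` for `0 ≤ t ≤ 1/200`. -/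
theorem sfc_succ_mul_succ_mul_pow_le {t : ℝ} (ht0 : 0 ≤ t) (ht : t ≤ 1 / 200) (n : ℕ) :
    ((n : ℝ) + 1) * ((n : ℝ) + 2) * t ^ n ≤ 2 * (1 / 50) ^ n := by
  calc ((n : ℝ) + 1) * ((n : ℝ) + 2) * t ^ n ≤ 2 * 4 ^ n * (1 / 200) ^ n :=
        mul_le_mul (sfc_succ_mul_succ_le n) (pow_le_pow_left₀ ht0 ht n) (by positivity)
          (by positivity)
    _ = 2 * (1 / 50) ^ n := by rw [mul_assoc, ← mul_pow]; norm_num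

/-! ### The series `𝐠(w) = ∑ Gₙ wⁿ`, `𝒟𝐠(w) = ∑ (1 − n) Gₙ wⁿ` at a point `0 ≤ w ≤ 1/(200R)` -/

section Point

variable {R : ℝ} {G : ℕ → ℝ} {w : ℝ}

/-- The uniform coefficient bound `|Gₙ| ≤ Rⁿ` from `G₀ = 1`, `|G₁| ≤ R`, `|Gₙ| ≤ Rⁿ⁻¹` (`n ≥ 2`),
`R ≥ 1`. -/
theorem sfc_coeff_le (hR : 1 ≤ R) (hG0 : G 0 = 1) (hG1 : |G 1| ≤ R)
    (hG : ∀ n, 2 ≤ n → |G n| ≤ R ^ (n - 1)) (n : ℕ) : |G n| ≤ R ^ n := by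
  rcases n with _ | _ | m
  · simp [hG0]
  · simpa using hG1
  · calc |G (m + 2)| ≤ R ^ (m + 2 - 1) := hG (m + 2) (by omega)
      _ ≤ R ^ (m + 2) := pow_le_pow_right₀ hR (by omega)

/-- `0 ≤ w` and `K w < 1/2` (`K > 0`) give `|w| < 1/(2K)`, the hypothesis of
`sfc_hasDerivAt_tsum_pow`. -/
theorem sfc_abs_lt_of_mul_lt {K : ℝ} (hK : 0 < K) (hw0 : 0 ≤ w) (hKw : K * w < 1 / 2) :
    |w| < 1 / (2 * K) := by
  rw [abs_of_nonneg hw0, lt_div_iff₀ (by positivity)]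
  linarith

/-- **`𝒟𝐠 = 𝐠 − w 𝐠'` term-wise**: `∑ (1 − n) Gₙ wⁿ = ∑ Gₙ wⁿ − w ∑ Gₙ (n wⁿ⁻¹)` (all three series
converge for `|Gₙ| ≤ Rⁿ`, `0 ≤ w`, `R w ≤ 1/200`). -/
theorem sfc_hasSum_dg (hR : 1 ≤ R) (hGR : ∀ n, |G n| ≤ R ^ n) (hw0 : 0 ≤ w)
    (hw : R * w ≤ 1 / 200) :
    HasSum (fun n : ℕ => (1 - (n : ℝ)) * G n * w ^ n)
      (∑' n, G n * w ^ n - w * ∑' n, G n * ((n : ℝ) * w ^ (n - 1))) := by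
  have hR0 : 0 < R := by linarith
  have hs1 : Summable fun n => G n * w ^ n :=
    sfc_summable_pow hR0.le (by rw [abs_of_nonneg hw0]; linarith) hGR
  have hs2 : Summable fun n => G n * ((n : ℝ) * w ^ (n - 1)) := by
    refine sfc_summable_of_abs_le_geom (B := 100 * R) (q := 1 / 100) (by norm_num) (by norm_num)
      fun n => ?_
    cases n with
    | zero => simp; positivity
    | succ m =>
      rw [Nat.add_sub_cancel, abs_mul, abs_mul, abs_pow, abs_of_nonneg hw0, Nat.abs_cast]
      push_cast
      calc |G (m + 1)| * (((m : ℝ) + 1) * w ^ m) ≤ R ^ (m + 1) * (((m : ℝ) + 1) * w ^ m) := by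
            gcongr; exact hGR _
        _ = R * (((m : ℝ) + 1) * (R * w) ^ m) := by rw [mul_pow]; ring
        _ ≤ R * (1 / 100) ^ m := by gcongr; exact sfc_succ_mul_pow_le (by positivity) hw m
        _ = 100 * R * (1 / 100) ^ (m + 1) := by ring
  have heq : (fun n : ℕ => (1 - (n : ℝ)) * G n * w ^ n) =
      fun n : ℕ => G n * w ^ n - w * (G n * ((n : ℝ) * w ^ (n - 1))) := by
    funext n
    cases n with
    | zero => simp
    | succ m => rw [Nat.add_sub_cancel]; push_cast; ring
  rw [heq]
  exact hs1.hasSum.sub (hs2.hasSum.mul_left w)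

/-- `|𝐠(w) − 1| ≤ 1/100` for `0 ≤ w`, `R w ≤ 1/200`. -/
theorem sfc_abs_g_sub_one_le (hR : 1 ≤ R) (hGR : ∀ n, |G n| ≤ R ^ n) (hG0 : G 0 = 1)
    (hw0 : 0 ≤ w) (hw : R * w ≤ 1 / 200) : |∑' n, G n * w ^ n - 1| ≤ 1 / 100 := by
  have hR0 : 0 < R := by linarith
  have hs : Summable fun n => G n * w ^ n :=
    sfc_summable_pow hR0.le (by rw [abs_of_nonneg hw0]; linarith) hGR
  have h0 : ∑ i ∈ Finset.range 1, G i * w ^ i = 1 := by simp [hG0]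
  have h1 : HasSum (fun n => G (n + 1) * w ^ (n + 1)) (∑' n, G n * w ^ n - 1) := by
    have := (hasSum_nat_add_iff' 1).2 hs.hasSum
    rwa [h0] at this
  have hb : ∀ n, |G (n + 1) * w ^ (n + 1)| ≤ 1 / 200 * (1 / 200) ^ n := fun n => by
    rw [abs_mul, abs_pow, abs_of_nonneg hw0]
    calc |G (n + 1)| * w ^ (n + 1) ≤ R ^ (n + 1) * w ^ (n + 1) := by gcongr; exact hGR _
      _ = (R * w) ^ (n + 1) := by rw [mul_pow]
      _ ≤ (1 / 200) ^ (n + 1) := pow_le_pow_left₀ (by positivity) hw (n + 1)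
      _ = 1 / 200 * (1 / 200) ^ n := by ring
  exact (sfc_abs_le_of_hasSum (by norm_num) (by norm_num) h1 hb).trans (by norm_num)

/-- `|𝒟𝐠(w) − 1| ≤ w/100` for `0 ≤ w`, `R w ≤ 1/200` — this uses the fine bound `|Gₙ| ≤ Rⁿ⁻¹`
(`n ≥ 2`): `|𝒟𝐠(w) − 1| ≤ ∑_{n ≥ 2} (n − 1) Rⁿ⁻¹ wⁿ = w · t/(1 − t)²`, `t = R w`. -/
theorem sfc_abs_dg_sub_one_le (hR : 1 ≤ R) (hG0 : G 0 = 1) (hG1 : |G 1| ≤ R)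
    (hG : ∀ n, 2 ≤ n → |G n| ≤ R ^ (n - 1)) (hw0 : 0 ≤ w) (hw : R * w ≤ 1 / 200) :
    |∑' n : ℕ, (1 - (n : ℝ)) * G n * w ^ n - 1| ≤ w / 100 := by
  have hR0 : 0 < R := by linarith
  have hGR := sfc_coeff_le hR hG0 hG1 hG
  have hs := (sfc_hasSum_dg hR hGR hw0 hw).summable.hasSum
  have h0 : ∑ i ∈ Finset.range 2, (1 - (i : ℝ)) * G i * w ^ i = 1 := by
    simp [Finset.sum_range_succ, hG0]
  have h2 : HasSum (fun n => (1 - ((n + 2 : ℕ) : ℝ)) * G (n + 2) * w ^ (n + 2))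
      (∑' n : ℕ, (1 - (n : ℝ)) * G n * w ^ n - 1) := by
    have := (hasSum_nat_add_iff' 2).2 hs
    rwa [h0] at this
  have hb : ∀ n : ℕ, |(1 - ((n + 2 : ℕ) : ℝ)) * G (n + 2) * w ^ (n + 2)| ≤
      w / 200 * (1 / 100) ^ n := fun n => by
    have hGn : |G (n + 2)| ≤ R ^ (n + 1) := hG (n + 2) (by omega)
    have habs : |1 - ((n + 2 : ℕ) : ℝ)| = (n : ℝ) + 1 := by
      push_cast
      rw [abs_of_nonpos (by linarith)]
      ring
    rw [abs_mul, abs_mul, abs_pow, abs_of_nonneg hw0, habs]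
    calc ((n : ℝ) + 1) * |G (n + 2)| * w ^ (n + 2)
        ≤ ((n : ℝ) + 1) * R ^ (n + 1) * w ^ (n + 2) := by gcongr
      _ = w * (R * w) * (((n : ℝ) + 1) * (R * w) ^ n) := by rw [mul_pow]; ring
      _ ≤ w * (1 / 200) * (1 / 100) ^ n :=
          mul_le_mul (mul_le_mul_of_nonneg_left hw hw0) (sfc_succ_mul_pow_le (by positivity) hw n)
            (by positivity) (by positivity)
      _ = w / 200 * (1 / 100) ^ n := by ring
  calc |∑' n : ℕ, (1 - (n : ℝ)) * G n * w ^ n - 1| ≤ w / 200 / (1 - 1 / 100) :=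
        sfc_abs_le_of_hasSum (by norm_num) (by norm_num) h2 hb
    _ ≤ w / 100 := by
        rw [div_le_div_iff₀ (by norm_num) (by norm_num)]
        nlinarith

/-- `|𝒟𝐠'(w)| = |∑ (1 − n) Gₙ n wⁿ⁻¹| ≤ 1/50` for `0 ≤ w`, `R w ≤ 1/200` (again from the fine
bound): `≤ ∑_{m ≥ 1} (m + 1) m tᵐ = 2t/(1 − t)³`, `t = R w`. -/
theorem sfc_abs_dg₁_le (hR : 1 ≤ R) (hG : ∀ n, 2 ≤ n → |G n| ≤ R ^ (n - 1)) (hw0 : 0 ≤ w)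
    (hw : R * w ≤ 1 / 200) :
    |∑' n : ℕ, (1 - (n : ℝ)) * G n * ((n : ℝ) * w ^ (n - 1))| ≤ 1 / 50 := by
  have hR0 : 0 < R := by linarith
  -- the shifted terms and their majorant `(1/100) (1/50)ᵐ`
  have hb : ∀ m : ℕ, |(1 - ((m + 2 : ℕ) : ℝ)) * G (m + 2) * (((m + 2 : ℕ) : ℝ) * w ^ (m + 2 - 1))|
      ≤ 1 / 100 * (1 / 50) ^ m := fun m => by
    have hGn : |G (m + 2)| ≤ R ^ (m + 1) := hG (m + 2) (by omega)
    have habs : |1 - ((m + 2 : ℕ) : ℝ)| = (m : ℝ) + 1 := by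
      push_cast
      rw [abs_of_nonpos (by linarith)]
      ring
    rw [show m + 2 - 1 = m + 1 from rfl, abs_mul, abs_mul, abs_mul, abs_pow, abs_of_nonneg hw0,
      habs, Nat.abs_cast]
    push_cast
    calc ((m : ℝ) + 1) * |G (m + 2)| * (((m : ℝ) + 2) * w ^ (m + 1))
        ≤ ((m : ℝ) + 1) * R ^ (m + 1) * (((m : ℝ) + 2) * w ^ (m + 1)) := by gcongr
      _ = (R * w) * (((m : ℝ) + 1) * ((m : ℝ) + 2) * (R * w) ^ m) := by rw [mul_pow]; ring
      _ ≤ (1 / 200) * (2 * (1 / 50) ^ m) :=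
          mul_le_mul hw (sfc_succ_mul_succ_mul_pow_le (by positivity) hw m) (by positivity)
            (by norm_num)
      _ = 1 / 100 * (1 / 50) ^ m := by ring
  -- summability of the full series (terms `0, 0`, then the shifted ones)
  have hs : Summable fun n : ℕ => (1 - (n : ℝ)) * G n * ((n : ℝ) * w ^ (n - 1)) := by
    rw [← summable_nat_add_iff 2]
    exact sfc_summable_of_abs_le_geom (by norm_num) (by norm_num) hb
  have h0 : ∑ i ∈ Finset.range 2, (1 - (i : ℝ)) * G i * ((i : ℝ) * w ^ (i - 1)) = 0 := by
    simp [Finset.sum_range_succ]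
  have h2 : HasSum
      (fun m => (1 - ((m + 2 : ℕ) : ℝ)) * G (m + 2) * (((m + 2 : ℕ) : ℝ) * w ^ (m + 2 - 1)))
      (∑' n : ℕ, (1 - (n : ℝ)) * G n * ((n : ℝ) * w ^ (n - 1)) - 0) := by
    have := (hasSum_nat_add_iff' 2).2 hs.hasSum
    rwa [h0] at this
  rw [← sub_zero (∑' n : ℕ, (1 - (n : ℝ)) * G n * ((n : ℝ) * w ^ (n - 1)))]
  exact (sfc_abs_le_of_hasSum (by norm_num) (by norm_num) h2 hb).trans (by norm_num)

/-- **The series package at a point.**  For `R ≥ 1`, `G₀ = 1`, `|G₁| ≤ R`, `|Gₙ| ≤ Rⁿ⁻¹` (`n ≥ 2`)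
and `0 ≤ w`, `R w ≤ 1/200`: the power series `𝐠(z) = ∑ Gₙ zⁿ` and `𝒟𝐠(z) = ∑ (1 − n) Gₙ zⁿ` are
differentiable at `w`, `𝒟𝐠(w) = 𝐠(w) − w 𝐠'(w)`, and `|𝐠(w) − 1| ≤ 1/100`,
`|𝒟𝐠(w) − 1| ≤ w/100`, `|𝒟𝐠'(w)| ≤ 1/50`. -/
theorem sfc_point (hR : 1 ≤ R) (hG0 : G 0 = 1) (hG1 : |G 1| ≤ R)
    (hG : ∀ n, 2 ≤ n → |G n| ≤ R ^ (n - 1)) (hw0 : 0 ≤ w) (hw : R * w ≤ 1 / 200) :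
    ∃ g₁ d₁ : ℝ,
      HasDerivAt (fun z => ∑' n, G n * z ^ n) g₁ w ∧
      HasDerivAt (fun z => ∑' n : ℕ, (1 - (n : ℝ)) * G n * z ^ n) d₁ w ∧
      ∑' n : ℕ, (1 - (n : ℝ)) * G n * w ^ n = ∑' n, G n * w ^ n - w * g₁ ∧
      |∑' n, G n * w ^ n - 1| ≤ 1 / 100 ∧
      |∑' n : ℕ, (1 - (n : ℝ)) * G n * w ^ n - 1| ≤ w / 100 ∧
      |d₁| ≤ 1 / 50 := by
  have hR0 : 0 < R := by linarith
  have hGR := sfc_coeff_le hR hG0 hG1 hG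
  -- the coefficients `(1 − n) Gₙ` are bounded by `(2R)ⁿ`
  have hbR : ∀ n : ℕ, |(1 - (n : ℝ)) * G n| ≤ (2 * R) ^ n := fun n => by
    rw [abs_mul, mul_pow]
    exact mul_le_mul (sfc_abs_one_sub_le_two_pow n) (hGR n) (abs_nonneg _) (by positivity)
  have hw1 : |w| < 1 / (2 * R) := sfc_abs_lt_of_mul_lt hR0 hw0 (by linarith)
  have hw2 : |w| < 1 / (2 * (2 * R)) := sfc_abs_lt_of_mul_lt (by positivity) hw0 (by linarith)
  refine ⟨_, _, sfc_hasDerivAt_tsum_pow hR0 hGR hw1,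
    sfc_hasDerivAt_tsum_pow (by positivity) hbR hw2, (sfc_hasSum_dg hR hGR hw0 hw).tsum_eq,
    sfc_abs_g_sub_one_le hR hGR hG0 hw0 hw, sfc_abs_dg_sub_one_le hR hG0 hG1 hG hw0 hw,
    sfc_abs_dg₁_le hR hG hw0 hw⟩

end Point

/-- Registered sub-goal `shiftFromCoeffs_seriesPoint` of `stub_shiftFromCoeffs` (verbatim signature):
the point package `sfc_point`. -/
theorem shiftFromCoeffs_seriesPoint : ∀ (R : ℝ) (G : ℕ → ℝ) (w : ℝ), 1 ≤ R → G 0 = 1 → |G 1| ≤ R →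
    (∀ n, 2 ≤ n → |G n| ≤ R ^ (n - 1)) → 0 ≤ w → R * w ≤ 1 / 200 →
    ∃ g₁ d₁ : ℝ, HasDerivAt (fun z => ∑' n : ℕ, G n * z ^ n) g₁ w ∧
      HasDerivAt (fun z => ∑' n : ℕ, (1 - (n : ℝ)) * G n * z ^ n) d₁ w ∧
      ∑' n : ℕ, (1 - (n : ℝ)) * G n * w ^ n = ∑' n : ℕ, G n * w ^ n - w * g₁ ∧
      |∑' n : ℕ, G n * w ^ n - 1| ≤ 1 / 100 ∧
      |∑' n : ℕ, (1 - (n : ℝ)) * G n * w ^ n - 1| ≤ w / 100 ∧ |d₁| ≤ 1 / 50 :=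
  fun _ _ _ hR hG0 hG1 hG hw0 hw => sfc_point hR hG0 hG1 hG hw0 hw

end Summit.FinalStateConjecture.FinalStateConjecture.Theorems.CrumPeelingRecessiveTower
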